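import Summits.PneNP.PneNP.Theorems.SfmBlSigningStep
import Summits.PneNP.PneNP.Theorems.SfmBlMachineGreedyFP
import Summits.PneNP.PneNP.Theorems.SfmBlMachineDictCount
import Summits.PneNP.PneNP.Theorems.SfmBlPipeline
import Summits.PneNP.PneNP.Theorems.SfmBlParamsGlue
import Summits.PneNP.PneNP.Theorems.Nc03AvoidResidualCoreCandCutNormSigning

/-!
# Line «sfm-bl», THE CLOSER: `CandCutNormSigningFP` (stmt-PneNP-20523)

FRONTIER F-N1c — a derandomised (polynomial-time) cut-norm signing for pure-`CAND` 3-local instances at linear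
stretch; nothing here bears on P vs NP.

Assembly of the line «sfm-bl» (PROOF-SFM-BL + MACHINE-PLAN of pnp-ideate-p3): the machine `sfmStr` of
`SfmBlMachineGreedy` is polynomial time (`isPolyTime_sfmStr`, M5-GREEDY typing) and, on the code of a pure-`CAND`
instance with `n ≥ 1` and `m ≥ 2^60·n`, prints the greedy signing `greedyBits m (trips I)`, which is CUT-CERTIFIED
by prover-2's `SfmBl.cutCertified_of_pipeline` instantiated with prover-1's dictionary (D1/D2: `srcM`, `dstM`, `own₁M`,
`own₂M`, `pM`, `V₁M`, `V₂M`, `decomposition_clauses`) and the machine semantics (M3-SEM `traceSum_sfm_eq`, M4-SEM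
`hatSum_sfm_eq`): the per-step greedy choice of the machine (ONE integer comparison, `potVal_greedyStep_le`) is the
greedy hypothesis through `SfmBl.frac_compare_int_iff` / `sfmBl_A₁_frac'` / `sfmBl_A₃_frac` and
`SfmBl.greedy_of_cylinder_steps`.  Main results: `cutCertified_greedyBits`, **`candCutNormSigningFP`**.
-/

set_option linter.dupNamespace false -- `Summit.PneNP.PneNP.…`: summit = sub-problem name (D-0017 single-conjunct layout)

namespace Summit.PneNP.PneNP.Theorems.SfmBlMachine

open Finset Matrix Literature.Computability.Complexity
open Summit.PneNP.PneNP.Theorems.Nc03AvoidResidualCoreCandFewHeadsRungFP (trips)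
open Summit.PneNP.PneNP.Theorems.CandCutNorm (boolSign CutCertified CandCutNormSigningFP)
open Summit.PneNP.PneNP.Theorems.SfmBl (IsConnectedPair bipGraph)

variable {n m : ℕ}

/-! ## The decomposition clauses for the machine's state -/

/-- prover-1's `decomposition_clauses` for the machine's own parameters (`t₀'`, cap `(40N)^121`, `3m+1` rounds);
`st` = the machine's extraction state, kept as a variable. -/
theorem decomp_sfm (I : LocalMap 3 n m) (hN1 : 1 ≤ sfmN (trips I)) (st : List ℕ × ℕ) (hst : sfmExtract (trips I) = st) :
    ∃ hlab : ∀ lab ∈ st.1, lab ≤ st.2,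
      (∀ (W₁ : Finset (LPiece L0 I)) (W₂ : Finset (RPiece L0 I)),
        ((bipGraph (fun i k => ∃ e, srcM L0 I e = i ∧ dstM L0 I e = k)).induce
            {x | Sum.elim (fun i => i ∈ W₁) (fun k => k ∈ W₂) x}).Connected →
        W₁.card + W₂.card ≤ prmT0' (sfmN (trips I)) →
        ((Finset.univ.filter fun e : Fin m × Fin 3 =>
            pM st.1 st.2 hlab e = none ∧ srcM L0 I e ∈ W₁ ∧ dstM L0 I e ∈ W₂).card : ℝ)
          ≤ (60 * Real.sqrt (6000 * 2 ^ 60)) * Real.sqrt ((W₁.card : ℝ) * (W₂.card : ℝ))) ∧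
      (∀ (s : Fin st.2) (e : Fin m × Fin 3), pM st.1 st.2 hlab e = some s →
        srcM L0 I e ∈ V₁M L0 I st.1 st.2 hlab s ∧ dstM L0 I e ∈ V₂M L0 I st.1 st.2 hlab s) ∧
      (∀ s : Fin st.2, (60 * Real.sqrt (6000 * 2 ^ 60)) *
          Real.sqrt (((V₁M L0 I st.1 st.2 hlab s).card : ℝ) * ((V₂M L0 I st.1 st.2 hlab s).card : ℝ))
        < ((Finset.univ.filter fun e : Fin m × Fin 3 => pM st.1 st.2 hlab e = some s).card : ℝ)) ∧
      (∀ s : Fin st.2, (V₁M L0 I st.1 st.2 hlab s).card + (V₂M L0 I st.1 st.2 hlab s).card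
        ≤ 2 * (Finset.univ.filter fun e : Fin m × Fin 3 => pM st.1 st.2 hlab e = some s).card) := by
  obtain ⟨_, hT0, _, hL2t0, _⟩ := params_bounds hN1
  have ht0' := prmT0'_eq hN1
  have hcap : ∀ k, k ≤ (List.replicate (2 * (prmT0' (sfmN (trips I)) - 1)) ()).length →
      (walksU (pieceLegs L0 (trips I)) k).length ≤ sfmCapW (trips I) := by
    intro k hk
    rw [List.length_replicate, ht0'] at hk
    refine (length_walksU_sub_le L0_pos (trips I) (List.Sublist.refl _) k).trans ?_
    unfold sfmCapW
    change sfmN (trips I) * L0 ^ k ≤ _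
    calc sfmN (trips I) * L0 ^ k ≤ sfmN (trips I) * L0 ^ (2 * prmT0 (sfmN (trips I))) :=
          Nat.mul_le_mul_left _ (Nat.pow_le_pow_right L0_pos (by omega))
      _ ≤ (40 * sfmN (trips I)) * (40 * sfmN (trips I)) ^ 120 := Nat.mul_le_mul (by omega) hL2t0
      _ = (40 * sfmN (trips I)) ^ 121 := by ring
  have hu₂ : (pieceLegs L0 (trips I)).length < (List.replicate ((sfmPlegs (trips I)).length + 1) ()).length := by
    rw [List.length_replicate]; exact Nat.lt_succ_self _
  have h := decomposition_clauses (L := L0) I (sfmCapW (trips I))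
    (prmT0' (sfmN (trips I))) (List.replicate (2 * (prmT0' (sfmN (trips I)) - 1)) ()) List.length_replicate hcap
    (List.replicate ((sfmPlegs (trips I)).length + 1) ()) hu₂
  have e : extract (3600 * (6000 * 2 ^ 60)) (pieceLegs L0 (trips I))
      (cands (pieceLegs L0 (trips I)) (sfmCapW (trips I)) (prmT0' (sfmN (trips I)))
        (List.replicate (2 * (prmT0' (sfmN (trips I)) - 1)) ()))
      (List.replicate ((sfmPlegs (trips I)).length + 1) ()) = st := hst
  subst e
  exact h

/-! ## The constants of the integer comparison -/

/-- `ℓ = 2^(j+2)` for the machine's `j = prmJ1 N − 1`. -/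
theorem sfmEll_eq (I : LocalMap 3 n m) (hN1 : 1 ≤ sfmN (trips I)) :
    sfmEll (trips I) = 2 ^ (prmJ1 (sfmN (trips I)) - 1 + 2) := by
  unfold sfmEll
  rw [prmQ1'_eq hN1, show prmJ1 (sfmN (trips I)) - 1 + 2 = prmJ1 (sfmN (trips I)) + 1 by
    have := prmJ1_sub_add hN1; omega, pow_succ, mul_comm]

/-- `V = Σ_s (|V₁ s| + |V₂ s|)`. -/
theorem sfmV_eq (I : LocalMap 3 n m) (st : List ℕ × ℕ) (hst : sfmExtract (trips I) = st)
    (hlab : ∀ lab ∈ st.1, lab ≤ st.2) :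
    sfmV (trips I) = ∑ s : Fin st.2, ((V₁M L0 I st.1 st.2 hlab s).card + (V₂M L0 I st.1 st.2 hlab s).card) := by
  subst hst
  have hlen := (sfmExtract_inv I).1
  unfold sfmV
  rw [sfmR'_eq, sum_map_range_eq, ← Fin.sum_univ_eq_sum_range]
  refine Finset.sum_congr rfl fun s _ => ?_
  rw [card_V₁M_eq_length_lpieces L0 I hlab hlen s, card_V₂M_eq_length_rpieces L0 I hlab hlen s]
  rfl

/-! ## The `F`-sum over a cylinder in the machine's integers -/

/-- THE CYLINDER SUM OF THE PIPELINE'S `F` through the machine's two integers: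
`Σ_{T ∈ cyl(kk,T0)} F T = traceSum / A₁ + hatSum / A₃`. -/
theorem sumF_eq (I : LocalMap 3 n m) (hN1 : 1 ≤ sfmN (trips I)) (st : List ℕ × ℕ) (hst : sfmExtract (trips I) = st)
    (hlab : ∀ lab ∈ st.1, lab ≤ st.2) {kk : ℕ} (hkk : kk ≤ m) (T0 : List Bool) (A₁ A₃ : ℝ) :
    ∑ T ∈ (univ : Finset (Fin m → Bool)).filter
        (fun T => ∀ i ∈ univ.filter (fun i : Fin m => (i : ℕ) < kk), T i = T0.getD i.val false),
      (((Matrix.fromBlocks 0 (MpS I st hlab T none) (MpS I st hlab T none)ᵀ 0)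
          ^ (2 ^ (prmJ1 (sfmN (trips I)) - 1 + 2))).trace / A₁
        + (∑ s, ∑ W ∈ badS I st hlab s T, meetS I st hlab s W) / A₃)
      = ((traceSum kk T0 (2 ^ (m - kk + 1)) (sfmRlegs (trips I)) (sfmCapA (trips I)) (sfmUA (trips I)) : ℤ) : ℝ) / A₁
        + ((hatSum G0 kk T0 m (sfmRecs (trips I)) : ℕ) : ℝ) / A₃ := by
  rw [Finset.sum_add_distrib, ← Finset.sum_div, ← Finset.sum_div, traceSum_sfm_eq I hN1 st hst hlab hkk T0,
    hatSum_sfm_eq I hN1 st hst hlab kk T0, ← sfmEll_eq I hN1]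
  rfl

/-! ## One greedy step -/

/-- Reading the extended prefix: positions `< |acc|` read `acc`, position `|acc|` reads the new bit. -/
theorem getD_append_single (acc : List Bool) (b : Bool) (i : ℕ) (hi : i ≤ acc.length) :
    (acc ++ [b]).getD i false = if i < acc.length then acc.getD i false else b := by
  split_ifs with h
  · exact List.getD_append _ _ _ _ h
  · rw [List.getD_append_right _ _ _ _ (not_lt.1 h), show i - acc.length = 0 by omega]; rfl

/-- **THE MACHINE'S CHOICE SATISFIES THE GREEDY HYPOTHESIS**: with `y` the greedy signing read by `readOut`, at every
step the `F`-sum over the cylinder of `y|_{k+1}` is at most the one over the sibling cylinder. -/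
theorem sumF_step_le (I : LocalMap 3 n m) (hN1 : 1 ≤ sfmN (trips I)) (st : List ℕ × ℕ) (hst : sfmExtract (trips I) = st)
    (hlab : ∀ lab ∈ st.1, lab ≤ st.2) {p₁ q₁ p₂ q₂ : ℕ} (hp₁ : 0 < p₁) (hq₁ : 0 < q₁) (hp₂ : 0 < p₂) (hq₂ : 0 < q₂)
    (hC₁ : sfmC₁ (trips I) = p₂ * q₁) (hC₂ : sfmC₂ (trips I) = p₁ * q₂) (k : ℕ) (hk : k < m) :
    let y : Fin m → Bool := readOut m (greedyBits m (trips I))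
    let F : (Fin m → Bool) → ℝ := fun T =>
      (((Matrix.fromBlocks 0 (MpS I st hlab T none) (MpS I st hlab T none)ᵀ 0)
          ^ (2 ^ (prmJ1 (sfmN (trips I)) - 1 + 2))).trace / ((p₁ : ℝ) / q₁)
        + (∑ s, ∑ W ∈ badS I st hlab s T, meetS I st hlab s W) / ((p₂ : ℝ) / q₂))
    ∑ T ∈ univ.filter (fun T : Fin m → Bool =>
        ∀ i ∈ univ.filter (fun i : Fin m => (i : ℕ) < k + 1), T i = y i), F T
      ≤ ∑ T ∈ univ.filter (fun T : Fin m → Bool =>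
        ∀ i ∈ univ.filter (fun i : Fin m => (i : ℕ) < k + 1),
          T i = Function.update y ⟨k, hk⟩ (!y ⟨k, hk⟩) i), F T := by
  intro y F
  set bits := greedyBits m (trips I) with hbits
  have hlen : bits.length = m := length_greedyBits m (trips I)
  set acc := bits.take k with hacc
  have hacc_len : acc.length = k := by rw [hacc, List.length_take, hlen, min_eq_left hk.le]
  -- the machine's step
  obtain ⟨b, hstep, hle⟩ := potVal_greedyStep_le m (trips I) acc
  have hpre : bits.take (k + 1) = acc ++ [b] := by rw [← hstep, hacc]; exact greedyBits_prefix m (trips I) hk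
  rw [hacc_len] at hle
  -- the new bit is `y k`
  have hyk : y ⟨k, hk⟩ = b := by
    show bits.getD k false = b
    rw [List.getD_eq_getElem _ _ (by rw [hlen]; exact hk)]
    have h1 : (bits.take (k + 1))[k]'(by rw [List.length_take, hlen]; omega) = bits[k] := List.getElem_take
    rw [← h1]
    simp only [hpre, List.getElem_append_right (le_of_eq hacc_len),  hacc_len, Nat.sub_self, List.getElem_cons_zero]
  -- positions below `k` read `acc`
  have hyi : ∀ i : Fin m, (i : ℕ) < k → y i = acc.getD i.val false := by
    intro i hi
    show bits.getD i.val false = _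
    rw [hacc, List.getD_eq_getElem _ _ (by rw [hlen]; exact i.isLt),
      List.getD_eq_getElem _ _ (by rw [List.length_take, hlen]; omega), List.getElem_take]
  -- the two cylinders in prefix form
  have hc₁ : (univ.filter fun T : Fin m → Bool => ∀ i ∈ univ.filter (fun i : Fin m => (i : ℕ) < k + 1), T i = y i)
      = univ.filter fun T : Fin m → Bool =>
          ∀ i ∈ univ.filter (fun i : Fin m => (i : ℕ) < k + 1), T i = (acc ++ [b]).getD i.val false := by
    refine SfmBl.cylinder_congr _ fun i hi => ?_
    rw [mem_filter] at hi
    rw [getD_append_single acc b i.val (by rw [hacc_len]; omega), hacc_len]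
    by_cases h : (i : ℕ) < k
    · rw [if_pos h]; exact hyi i h
    · rw [if_neg h]
      have : i = ⟨k, hk⟩ := Fin.ext (by simp only; omega)
      rw [this]; exact hyk
  have hc₂ : (univ.filter fun T : Fin m → Bool => ∀ i ∈ univ.filter (fun i : Fin m => (i : ℕ) < k + 1),
        T i = Function.update y ⟨k, hk⟩ (!y ⟨k, hk⟩) i)
      = univ.filter fun T : Fin m → Bool =>
          ∀ i ∈ univ.filter (fun i : Fin m => (i : ℕ) < k + 1), T i = (acc ++ [!b]).getD i.val false := by
    refine SfmBl.cylinder_congr _ fun i hi => ?_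
    rw [mem_filter] at hi
    rw [getD_append_single acc (!b) i.val (by rw [hacc_len]; omega), hacc_len]
    by_cases h : (i : ℕ) < k
    · rw [if_pos h, Function.update_of_ne (fun he => by rw [he] at h; exact lt_irrefl _ h)]; exact hyi i h
    · rw [if_neg h]
      have : i = ⟨k, hk⟩ := Fin.ext (by simp only; omega)
      rw [this, Function.update_self, hyk]
  rw [hc₁, hc₂]
  -- the sums through the machine's integers, then the integer comparison
  have hkk : k + 1 ≤ m := hk
  rw [sumF_eq I hN1 st hst hlab hkk (acc ++ [b]) _ _, sumF_eq I hN1 st hst hlab hkk (acc ++ [!b]) _ _,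
    ← Int.cast_natCast (R := ℝ) (hatSum G0 (k + 1) (acc ++ [b]) m (sfmRecs (trips I))),
    ← Int.cast_natCast (R := ℝ) (hatSum G0 (k + 1) (acc ++ [!b]) m (sfmRecs (trips I))),
    SfmBl.frac_compare_int_iff hp₁ hq₁ hp₂ hq₂]
  have e : potVal m (trips I) (k + 1) (acc ++ [b]) ≤ potVal m (trips I) (k + 1) (acc ++ [!b]) := hle
  unfold potVal at e
  rw [hC₁, hC₂] at e
  exact e

/-! ## The certificate -/

/-- **THE GREEDY SIGNING OF THE MACHINE IS CUT-CERTIFIED** (`n ≥ 1`, `m ≥ 2^60·n`). -/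
theorem cutCertified_greedyBits (I : LocalMap 3 n m) (hn : 0 < n) (hm : 2 ^ 60 * n ≤ m) :
    CutCertified I (readOut m (greedyBits m (trips I))) := by
  classical
  have hm0 : 0 < m := lt_of_lt_of_le (Nat.mul_pos (by positivity) hn) hm
  have hNeq : sfmN (trips I) = Fintype.card (LPiece L0 I) + Fintype.card (RPiece L0 I) := length_pieces_eq_card L0 I
  have hN1 : 1 ≤ sfmN (trips I) := by rw [hNeq]; exact one_le_card_pieces L0 I hm0
  obtain ⟨hlab, hsp', hsides, hdense, hcov⟩ := decomp_sfm I hN1 _ rfl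
  have hsp := fun W₁ W₂ hc (hs : W₁.card + W₂.card ≤ prmT0 (sfmN (trips I))) =>
    hsp' W₁ W₂ hc (by rw [prmT0'_eq hN1]; exact hs)
  -- parameters
  have hb : prmB (sfmN (trips I)) = Nat.size (Fintype.card (LPiece L0 I) + Fintype.card (RPiece L0 I)) := by
    rw [← hNeq]; rfl
  have hj : prmJ1 (sfmN (trips I)) - 1 + 1
      = Nat.size (Nat.size (20 * (Fintype.card (LPiece L0 I) + Fintype.card (RPiece L0 I)))) := by
    rw [prmJ1_sub_add hN1, ← hNeq]; rfl
  obtain ⟨hNb, ht₀, hjj⟩ := SfmBl.sfmBl_params_spec_real hb hj (prmT0_eq' hN1)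
  have hN : ((Fintype.card (LPiece L0 I) : ℝ) + Fintype.card (RPiece L0 I)) ≤ 2 * n + 1 + 6 * m / 2 ^ 60 := by
    have := card_pieces_le_real L0_pos I
    simp only [L0, Nat.cast_pow, Nat.cast_ofNat] at this
    exact this
  -- the fractions
  obtain ⟨hp₁, hq₁, hp₂, hq₂⟩ := SfmBl.sfmBl_fracs_pos (Fintype.card (LPiece L0 I) + Fintype.card (RPiece L0 I))
    (2 ^ (prmJ1 (sfmN (trips I)) - 1 + 2))
    (∑ s : Fin (sfmExtract (trips I)).2,
      ((V₁M L0 I (sfmExtract (trips I)).1 (sfmExtract (trips I)).2 hlab s).card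
        + (V₂M L0 I (sfmExtract (trips I)).1 (sfmExtract (trips I)).2 hlab s).card))
  have hC₁ : sfmC₁ (trips I) = 6 * (4 * (∑ s : Fin (sfmExtract (trips I)).2,
      ((V₁M L0 I (sfmExtract (trips I)).1 (sfmExtract (trips I)).2 hlab s).card
        + (V₂M L0 I (sfmExtract (trips I)).1 (sfmExtract (trips I)).2 hlab s).card)) + (2 ^ 60) ^ 10)
      * 20 ^ (2 ^ (prmJ1 (sfmN (trips I)) - 1 + 2)) := by
    unfold sfmC₁; rw [sfmV_eq I _ rfl hlab, sfmEll_eq I hN1]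
  have hC₂ : sfmC₂ (trips I) = 10 * ((Fintype.card (LPiece L0 I) + Fintype.card (RPiece L0 I))
      * 2 ^ (60 * 2 ^ (prmJ1 (sfmN (trips I)) - 1 + 2)) + 20 ^ (2 ^ (prmJ1 (sfmN (trips I)) - 1 + 2)))
      * (5 * (2 ^ 60) ^ 10) := by
    unfold sfmC₂; rw [← hNeq, sfmEll_eq I hN1]
  -- the pipeline
  refine SfmBl.cutCertified_of_pipeline I hn hm (srcM L0 I) (dstM L0 I) (own₁M L0 I) (own₂M L0 I)
    (own₁M_srcM L0 I) (own₂M_dstM_zero L0 I) (own₂M_dstM_one L0 I) (own₂M_dstM_two L0 I)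
    (card_filter_srcM_le L0_pos I) (card_filter_dstM_le L0_pos I) (one_le_card_pieces L0 I hm0) hN
    (prmJ1 (sfmN (trips I)) - 1) (prmB (sfmN (trips I))) (prmT0 (sfmN (trips I))) hNb ht₀ hjj
    (sfmExtract (trips I)).2 (pM (sfmExtract (trips I)).1 (sfmExtract (trips I)).2 hlab)
    (V₁M L0 I (sfmExtract (trips I)).1 (sfmExtract (trips I)).2 hlab)
    (V₂M L0 I (sfmExtract (trips I)).1 (sfmExtract (trips I)).2 hlab) hsp hsides hdense hcov
    (MpS I (sfmExtract (trips I)) hlab) (fun _ _ _ _ => rfl)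
    (WS I (sfmExtract (trips I)) hlab) (mem_WS_iff I (sfmExtract (trips I)) hlab)
    (badS I (sfmExtract (trips I)) hlab) (mem_badS_iff I (sfmExtract (trips I)) hlab) _ (fun _ => rfl)
    (readOut m (greedyBits m (trips I))) fun k hk => ?_
  -- the greedy hypothesis
  rw [SfmBl.sfmBl_A₁_frac' (Fintype.card (LPiece L0 I)) (Fintype.card (RPiece L0 I)),
    SfmBl.sfmBl_A₃_frac]
  refine SfmBl.greedy_of_cylinder_steps _ _ (fun k' hk' => ?_) k hk
  have h := sumF_step_le I hN1 _ rfl hlab hp₁ hq₁ hp₂ hq₂ hC₁ hC₂ k' hk'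
  exact h

/-! ## The closer -/

/-- **`CandCutNormSigningFP` (stmt-PneNP-20523): cut-norm signing for pure-`CAND` at linear stretch is in FP** —
with the constant `C = 2^60` and the machine `sfmStr` (decoder + block splitting + spot extraction + derandomised
greedy signing by the method of conditional expectations on `tr(A^{2^{j+2}})/A₁ + Σ_s ê_s/A₃`). -/
theorem candCutNormSigningFP : CandCutNormSigningFP := by
  refine ⟨2 ^ 60, sfmStr, isPolyTime_sfmStr, fun n m I hI hn hm => ?_⟩
  rw [sfmStr_encode hI]
  exact cutCertified_greedyBits I hn hm

end Summit.PneNP.PneNP.Theorems.SfmBlMachine
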